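import Literature.AlgebraicGeometry.HodgeTheory.FermatHodgeCharacterCriterion
import HarnessLib

/-!
# The Hodge condition at a conductor `f` prime to `6`, met at the exact levels `f, 2f, 3f, 4f, 6f, 12f` — Aoki 1983, Prop. 2.2

Topic `Literature/AlgebraicGeometry/HodgeTheory`. THEOREMS only (no definition, no named fact, no `sorry`).
Support file (XXVI), the common refinement of `FermatHodgeCharacterSixthConductor` (XXV: levels
`f, 2f, 3f, 6f`) and `FermatHodgeCharacterOddConductor` (XXI: levels `f, 2f, 4f`): here the
conductor `f` is prime to `6` and the levels meeting it are among `f, 2f, 3f, 4f, 6f, 12f` — all of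
them when the level of the Hodge character is `m = 12d`, `d` prime to `6`, and `f = d` (Aoki's
"`τ₁₂(α) ∈ A(m/12)`", [Aoki1983, Thm. C] §9 (III-7) Case (iv) p. 51: "considering `τ₁₂(α)`, we have
`-2⁻¹ + b' ≡ 1 + c' ≡ 0 (mod m/4)`"; route K₁₂ of the cell's scoping document, `m = 4n`, `n` odd,
`3 ∥ n`). The level `12f` and `6f` carry the Euler factor `(1 - χ(2))(1 - χ(3))`, the levels `4f`,
`2f` the factor `1 - χ(2)`, the level `3f` the factor `1 - χ(3)`, and the weights `φ(m)/φ(Mᵢ)` are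
proportional to `4 : 4 : 2 : 2 : 2 : 1` for `Mᵢ = f, 2f, 4f, 3f, 6f, 12f`
(`φ(2f) = φ(f)`, `φ(4f) = φ(3f) = φ(6f) = 2φ(f)`, `φ(12f) = 4φ(f)`).

For a Hodge character `α : Fin r → ℤ/m`, `αᵢ = (m/Mᵢ) wᵢ` (`Mᵢ ∣ m` the exact level, `wᵢ` a unit mod `Mᵢ`),
`f ∣ m` prime to `6` such that every `Mᵢ` divisible by `f` is one of `f, 2f, 3f, 4f, 6f, 12f`, and an odd
primitive character `χ` mod `f` — **`IsHodge.rel_twelfth_conductor_conj`** —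
`∑_{Mᵢ = 12f} (1 - conj χ(2))(1 - conj χ(3)) χ(w̄ᵢ) + 2 ∑_{Mᵢ = 6f} (1 - conj χ(2))(1 - conj χ(3)) χ(w̄ᵢ)
  + 2 ∑_{Mᵢ = 4f} (1 - conj χ(2)) χ(w̄ᵢ) + 2 ∑_{Mᵢ = 3f} (1 - conj χ(3)) χ(w̄ᵢ)
  + 4 ∑_{Mᵢ = 2f} (1 - conj χ(2)) χ(w̄ᵢ) + 4 ∑_{Mᵢ = f} χ(w̄ᵢ) = 0` (`w̄ᵢ = wᵢ mod f`).
Section `TwelfthLevel`: **`IsHodge.rel_twelfth_level`** — the same relation at a level `m = 12d`, `d`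
prime to `6`, as a function of the coordinates `αᵢ` themselves (the exact level of `αᵢ` is read off
from `IsUnit αᵢ`, `IsUnit (αᵢ mod d)`, `αᵢ mod 4`, `αᵢ mod 3`; `twelfth_term`), in the style of
`IsHodge.rel_sixth_level` (XXV) and `IsHodge.rel_quarter_level` (XX).

HONEST FRAMING (cell `pub-hfermat`): explicit algebraic cycles for specific Hodge classes on
Fermat/Delsarte varieties; residual open instances listed; no claim on general Hodge. (Surface
classes are algebraic by Lefschetz (1,1); this file is a relation among Hodge characters, no case
of HC.)

## References
* [Aoki1983] N. Aoki, *On some arithmetic problems related to the Hodge cycles on the Fermat varieties*,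
  Math. Ann. 266 (1983) 23–54 — Props. 2.1, 2.2 (pp. 28–29), §9 (III-7) Case (iv) p. 51 (`τ₁₂`).
-/

noncomputable section

open Finset

namespace Literature.AlgebraicGeometry.HodgeTheory

namespace FermatCharacter

section TwelfthConductor

variable {m : ℕ}

/-- `χ` vanishes at the primes of its level: `∏_{p ∣ f} (1 - χ(p)) = 1`. [folklore] -/
private theorem prod_primeFactors_one_sub_eq_one₁₂ {f : ℕ} (χ : DirichletCharacter ℂ f) :
    ∏ p ∈ f.primeFactors, (1 - χ (p : ZMod f)) = 1 := by
  refine Finset.prod_eq_one fun p hp ↦ ?_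
  have hpf : p ∣ f := Nat.dvd_of_mem_primeFactors hp
  have hp1 : p.Prime := Nat.prime_of_mem_primeFactors hp
  have hnu : ¬ IsUnit ((p : ℕ) : ZMod f) := by
    rw [ZMod.isUnit_iff_coprime]
    intro hc
    exact hp1.one_lt.ne' (Nat.Coprime.eq_one_of_dvd hc hpf)
  rw [χ.map_nonunit hnu, sub_zero]

/-- **[Aoki1983, Prop. 2.2] at a conductor `f` prime to `6`, met only at the exact levels
`f, 2f, 3f, 4f, 6f, 12f`.** Let `α = (α₀, …, α_{r-1})` be a Hodge character of level `m`,
`αᵢ = (m/Mᵢ) wᵢ` with `Mᵢ ∣ m` and `wᵢ` a unit mod `Mᵢ`, and let `f ∣ m` with `2 ∤ f`, `3 ∤ f` be such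
that every `Mᵢ` divisible by `f` is `f`, `2f`, `3f`, `4f`, `6f` or `12f`. Then for every odd primitive
character `χ` mod `f`:
`∑_{Mᵢ = 12f} (1 - χ(2))(1 - χ(3)) (χ w̄ᵢ)⁻¹ + 2 ∑_{Mᵢ = 6f} (1 - χ(2))(1 - χ(3)) (χ w̄ᵢ)⁻¹
  + 2 ∑_{Mᵢ = 4f} (1 - χ(2)) (χ w̄ᵢ)⁻¹ + 2 ∑_{Mᵢ = 3f} (1 - χ(3)) (χ w̄ᵢ)⁻¹
  + 4 ∑_{Mᵢ = 2f} (1 - χ(2)) (χ w̄ᵢ)⁻¹ + 4 ∑_{Mᵢ = f} (χ w̄ᵢ)⁻¹ = 0`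
(`w̄ᵢ = wᵢ mod f`; the weights `φ(m)/φ(Mᵢ)` are `c/4, c/2, c/2, c/2, c, c` for
`Mᵢ = 12f, 6f, 4f, 3f, 2f, f`, `c = φ(m)/φ(f)`). [cite: Aoki1983, Prop. 2.2 with Prop. 2.1; §9 (III-7) p. 51] -/
theorem IsHodge.rel_twelfth_conductor [NeZero m] {r : ℕ} {α : Fin r → ZMod m} (h : IsHodge α)
    {f : ℕ} [NeZero f] (h2 : ¬ 2 ∣ f) (h3 : ¬ 3 ∣ f) (hfm : f ∣ m) {χ : DirichletCharacter ℂ f}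
    (hχ : χ.Odd) (hprim : χ.IsPrimitive) (M : Fin r → ℕ) [∀ i, NeZero (M i)] (hM : ∀ i, M i ∣ m)
    (w : (i : Fin r) → ZMod (M i)) (hw : ∀ i, IsUnit (w i))
    (hα : ∀ i, α i = ((m / M i : ℕ) : ZMod m) * ((ZMod.val (w i) : ℕ) : ZMod m))
    (hlev : ∀ i, f ∣ M i → M i = f ∨ M i = 2 * f ∨ M i = 3 * f ∨ M i = 4 * f ∨ M i = 6 * f ∨
      M i = 12 * f) :
    ∑ i, (if M i = 12 * f then (1 - χ 2) * (1 - χ 3) * (χ (ZMod.cast (w i) : ZMod f))⁻¹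
      else if M i = 6 * f then 2 * (1 - χ 2) * (1 - χ 3) * (χ (ZMod.cast (w i) : ZMod f))⁻¹
      else if M i = 4 * f then 2 * (1 - χ 2) * (χ (ZMod.cast (w i) : ZMod f))⁻¹
      else if M i = 3 * f then 2 * (1 - χ 3) * (χ (ZMod.cast (w i) : ZMod f))⁻¹
      else if M i = 2 * f then 4 * (1 - χ 2) * (χ (ZMod.cast (w i) : ZMod f))⁻¹
      else if M i = f then 4 * (χ (ZMod.cast (w i) : ZMod f))⁻¹ else 0) = 0 := by
  classical
  have hm0 : m ≠ 0 := NeZero.ne m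
  have hf0 : f ≠ 0 := NeZero.ne f
  have key := h.aoki_criterion hfm hχ hprim M hM w hw hα
  have hφf : ((f.totient : ℕ) : ℂ) ≠ 0 := by
    exact_mod_cast (Nat.totient_pos.mpr (Nat.pos_of_ne_zero hf0)).ne'
  set c : ℂ := (m.totient : ℂ) / (f.totient : ℂ) with hc
  have hc0 : c ≠ 0 := div_ne_zero
    (by exact_mod_cast (Nat.totient_pos.mpr (Nat.pos_of_ne_zero hm0)).ne') hφf
  have hne12 : f ≠ 2 * f := by omega
  have hne13 : f ≠ 3 * f := by omega
  have hne14 : f ≠ 4 * f := by omega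
  have hne16 : f ≠ 6 * f := by omega
  have hne112 : f ≠ 12 * f := by omega
  have hne23 : 2 * f ≠ 3 * f := by omega
  have hne24 : 2 * f ≠ 4 * f := by omega
  have hne26 : 2 * f ≠ 6 * f := by omega
  have hne212 : 2 * f ≠ 12 * f := by omega
  have hne34 : 3 * f ≠ 4 * f := by omega
  have hne36 : 3 * f ≠ 6 * f := by omega
  have hne312 : 3 * f ≠ 12 * f := by omega
  have hne46 : 4 * f ≠ 6 * f := by omega
  have hne412 : 4 * f ≠ 12 * f := by omega
  have hne612 : 6 * f ≠ 12 * f := by omega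
  have hcop2 : Nat.Coprime 2 f := (Nat.Prime.coprime_iff_not_dvd Nat.prime_two).mpr h2
  have hcop3 : Nat.Coprime 3 f := (Nat.Prime.coprime_iff_not_dvd Nat.prime_three).mpr h3
  have hcop4 : Nat.Coprime 4 f := by
    rw [show (4 : ℕ) = 2 ^ 2 by norm_num]; exact Nat.Coprime.pow_left 2 hcop2
  have hcop6 : Nat.Coprime 6 f := by
    rw [show (6 : ℕ) = 2 * 3 by norm_num]; exact Nat.Coprime.mul_left hcop2 hcop3
  have hcop12 : Nat.Coprime 12 f := by
    rw [show (12 : ℕ) = 4 * 3 by norm_num]; exact Nat.Coprime.mul_left hcop4 hcop3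
  have h2nmem : (2 : ℕ) ∉ f.primeFactors := fun h ↦ h2 (Nat.dvd_of_mem_primeFactors h)
  have h3nmem : (3 : ℕ) ∉ f.primeFactors := fun h ↦ h3 (Nat.dvd_of_mem_primeFactors h)
  have hpf2 : ∏ p ∈ (2 * f).primeFactors, (1 - χ (p : ZMod f)) = 1 - χ 2 := by
    rw [Nat.primeFactors_mul (by norm_num) hf0, Nat.prime_two.primeFactors,
      show ({2} ∪ f.primeFactors : Finset ℕ) = insert 2 f.primeFactors from rfl,
      Finset.prod_insert h2nmem, prod_primeFactors_one_sub_eq_one₁₂ χ, mul_one, Nat.cast_ofNat]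
  have hpf4 : ∏ p ∈ (4 * f).primeFactors, (1 - χ (p : ZMod f)) = 1 - χ 2 := by
    rw [Nat.primeFactors_mul (by norm_num) hf0,
      show (4 : ℕ).primeFactors = {2} by
        rw [show (4 : ℕ) = 2 ^ 2 by norm_num, Nat.primeFactors_prime_pow two_ne_zero Nat.prime_two],
      show ({2} ∪ f.primeFactors : Finset ℕ) = insert 2 f.primeFactors from rfl,
      Finset.prod_insert h2nmem, prod_primeFactors_one_sub_eq_one₁₂ χ, mul_one, Nat.cast_ofNat]
  have hpf3 : ∏ p ∈ (3 * f).primeFactors, (1 - χ (p : ZMod f)) = 1 - χ 3 := by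
    rw [Nat.primeFactors_mul (by norm_num) hf0, Nat.prime_three.primeFactors,
      show ({3} ∪ f.primeFactors : Finset ℕ) = insert 3 f.primeFactors from rfl,
      Finset.prod_insert h3nmem, prod_primeFactors_one_sub_eq_one₁₂ χ, mul_one, Nat.cast_ofNat]
  have h3f0 : 3 * f ≠ 0 := by positivity
  have h2nmem' : (2 : ℕ) ∉ (3 * f).primeFactors := by
    intro h
    have h23 : (2 : ℕ) ∣ 3 * f := Nat.dvd_of_mem_primeFactors h
    exact h2 ((Nat.Coprime.dvd_of_dvd_mul_left (by norm_num : Nat.Coprime 2 3)) h23)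
  have hpf6 : ∏ p ∈ (6 * f).primeFactors, (1 - χ (p : ZMod f)) = (1 - χ 2) * (1 - χ 3) := by
    rw [show 6 * f = 2 * (3 * f) by ring, Nat.primeFactors_mul (by norm_num) h3f0,
      Nat.prime_two.primeFactors,
      show ({2} ∪ (3 * f).primeFactors : Finset ℕ) = insert 2 (3 * f).primeFactors from rfl,
      Finset.prod_insert h2nmem', hpf3, Nat.cast_ofNat]
  have hpf12 : ∏ p ∈ (12 * f).primeFactors, (1 - χ (p : ZMod f)) = (1 - χ 2) * (1 - χ 3) := by
    rw [show 12 * f = 4 * (3 * f) by ring, Nat.primeFactors_mul (by norm_num) h3f0,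
      show (4 : ℕ).primeFactors = {2} by
        rw [show (4 : ℕ) = 2 ^ 2 by norm_num, Nat.primeFactors_prime_pow two_ne_zero Nat.prime_two],
      show ({2} ∪ (3 * f).primeFactors : Finset ℕ) = insert 2 (3 * f).primeFactors from rfl,
      Finset.prod_insert h2nmem', hpf3, Nat.cast_ofNat]
  have ht2 : ((2 * f).totient : ℂ) = f.totient := by
    rw [Nat.totient_mul hcop2, show Nat.totient 2 = 1 by decide, one_mul]
  have ht4 : ((4 * f).totient : ℂ) = 2 * f.totient := by
    rw [Nat.totient_mul hcop4, show Nat.totient 4 = 2 by decide]; push_cast; ring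
  have ht3 : ((3 * f).totient : ℂ) = 2 * f.totient := by
    rw [Nat.totient_mul hcop3, show Nat.totient 3 = 2 by decide]; push_cast; ring
  have ht6 : ((6 * f).totient : ℂ) = 2 * f.totient := by
    rw [Nat.totient_mul hcop6, show Nat.totient 6 = 2 by decide]; push_cast; ring
  have ht12 : ((12 * f).totient : ℂ) = 4 * f.totient := by
    rw [Nat.totient_mul hcop12, show Nat.totient 12 = 4 by decide]; push_cast; ring
  have hterm : ∀ i, (if f ∣ M i then ((m.totient : ℂ) / ((M i).totient : ℂ)) *
        (∏ p ∈ (M i).primeFactors, (1 - χ p)) * (χ (ZMod.cast (w i) : ZMod f))⁻¹ else 0) =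
      (c / 4) * (if M i = 12 * f then (1 - χ 2) * (1 - χ 3) * (χ (ZMod.cast (w i) : ZMod f))⁻¹
        else if M i = 6 * f then 2 * (1 - χ 2) * (1 - χ 3) * (χ (ZMod.cast (w i) : ZMod f))⁻¹
        else if M i = 4 * f then 2 * (1 - χ 2) * (χ (ZMod.cast (w i) : ZMod f))⁻¹
        else if M i = 3 * f then 2 * (1 - χ 3) * (χ (ZMod.cast (w i) : ZMod f))⁻¹
        else if M i = 2 * f then 4 * (1 - χ 2) * (χ (ZMod.cast (w i) : ZMod f))⁻¹
        else if M i = f then 4 * (χ (ZMod.cast (w i) : ZMod f))⁻¹ else 0) := by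
    intro i
    by_cases hfi : f ∣ M i
    · rw [if_pos hfi]
      rcases hlev i hfi with h1 | h2' | h3' | h4' | h6' | h12'
      · -- exact level `f`
        have ht : ((M i).totient : ℂ) = f.totient := by rw [h1]
        have hp : ∏ p ∈ (M i).primeFactors, (1 - χ (p : ZMod f)) = 1 := by
          rw [h1]; exact prod_primeFactors_one_sub_eq_one₁₂ χ
        rw [ht, hp, if_neg (by rw [h1]; exact hne112), if_neg (by rw [h1]; exact hne16),
          if_neg (by rw [h1]; exact hne14), if_neg (by rw [h1]; exact hne13),
          if_neg (by rw [h1]; exact hne12), if_pos h1, hc]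
        ring
      · -- exact level `2f`
        have ht : ((M i).totient : ℂ) = f.totient := by rw [h2']; exact ht2
        have hp : ∏ p ∈ (M i).primeFactors, (1 - χ (p : ZMod f)) = 1 - χ 2 := by
          rw [h2']; exact hpf2
        rw [ht, hp, if_neg (by rw [h2']; exact hne212), if_neg (by rw [h2']; exact hne26),
          if_neg (by rw [h2']; exact hne24), if_neg (by rw [h2']; exact hne23), if_pos h2', hc]
        ring
      · -- exact level `3f`
        have ht : ((M i).totient : ℂ) = 2 * f.totient := by rw [h3']; exact ht3
        have hp : ∏ p ∈ (M i).primeFactors, (1 - χ (p : ZMod f)) = 1 - χ 3 := by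
          rw [h3']; exact hpf3
        rw [ht, hp, if_neg (by rw [h3']; exact hne312), if_neg (by rw [h3']; exact hne36),
          if_neg (by rw [h3']; exact hne34), if_pos h3', hc]
        field_simp
        ring
      · -- exact level `4f`
        have ht : ((M i).totient : ℂ) = 2 * f.totient := by rw [h4']; exact ht4
        have hp : ∏ p ∈ (M i).primeFactors, (1 - χ (p : ZMod f)) = 1 - χ 2 := by
          rw [h4']; exact hpf4
        rw [ht, hp, if_neg (by rw [h4']; exact hne412), if_neg (by rw [h4']; exact hne46), if_pos h4',
          hc]
        field_simp
        ring
      · -- exact level `6f`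
        have ht : ((M i).totient : ℂ) = 2 * f.totient := by rw [h6']; exact ht6
        have hp : ∏ p ∈ (M i).primeFactors, (1 - χ (p : ZMod f)) = (1 - χ 2) * (1 - χ 3) := by
          rw [h6']; exact hpf6
        rw [ht, hp, if_neg (by rw [h6']; exact hne612), if_pos h6', hc]
        field_simp
        ring
      · -- exact level `12f`
        have ht : ((M i).totient : ℂ) = 4 * f.totient := by rw [h12']; exact ht12
        have hp : ∏ p ∈ (M i).primeFactors, (1 - χ (p : ZMod f)) = (1 - χ 2) * (1 - χ 3) := by
          rw [h12']; exact hpf12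
        rw [ht, hp, if_pos h12', hc]
        field_simp
    · have hne12' : ¬ M i = 12 * f := fun h' ↦ hfi (h' ▸ dvd_mul_left f 12)
      have hne6 : ¬ M i = 6 * f := fun h' ↦ hfi (h' ▸ dvd_mul_left f 6)
      have hne4 : ¬ M i = 4 * f := fun h' ↦ hfi (h' ▸ dvd_mul_left f 4)
      have hne3 : ¬ M i = 3 * f := fun h' ↦ hfi (h' ▸ dvd_mul_left f 3)
      have hne2 : ¬ M i = 2 * f := fun h' ↦ hfi (h' ▸ dvd_mul_left f 2)
      have hne1 : ¬ M i = f := fun h1 ↦ hfi (h1 ▸ dvd_refl f)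
      rw [if_neg hfi, if_neg hne12', if_neg hne6, if_neg hne4, if_neg hne3, if_neg hne2, if_neg hne1,
        mul_zero]
  rw [Finset.sum_congr rfl (fun i _ ↦ hterm i), ← Finset.mul_sum] at key
  exact (mul_eq_zero.mp key).resolve_left (div_ne_zero hc0 (by norm_num : (4 : ℂ) ≠ 0))

/-- **[Aoki1983, Prop. 2.2] at a conductor `f` prime to `6`, met at the exact levels
`f, 2f, 3f, 4f, 6f, 12f` — with character values.** Under the hypotheses of
`IsHodge.rel_twelfth_conductor`:
`∑_{Mᵢ = 12f} (1 - conj χ(2))(1 - conj χ(3)) χ(w̄ᵢ) + 2 ∑_{Mᵢ = 6f} (1 - conj χ(2))(1 - conj χ(3)) χ(w̄ᵢ)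
  + 2 ∑_{Mᵢ = 4f} (1 - conj χ(2)) χ(w̄ᵢ) + 2 ∑_{Mᵢ = 3f} (1 - conj χ(3)) χ(w̄ᵢ)
  + 4 ∑_{Mᵢ = 2f} (1 - conj χ(2)) χ(w̄ᵢ) + 4 ∑_{Mᵢ = f} χ(w̄ᵢ) = 0`
for every odd primitive `χ` mod `f` (complex conjugate of `rel_twelfth_conductor`, `|χ(u)| = 1` on
units): with `2v₂ = -1`, `3v₃ = -1` the points of level `12f` are quadruples `w̄, v₂w̄, v₃w̄, v₂v₃w̄`
of weight `1`, those of level `6f` quadruples of weight `2`, those of level `4f` `2`-twins of weight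
`2`, those of level `3f` `3`-twins of weight `2`, those of level `2f` `2`-twins of weight `4`, those
of level `f` single points of weight `4` — Aoki's "`τ₁₂(α)`".
[cite: Aoki1983, Prop. 2.2; §9 (III-7) Case (iv) p. 51] -/
theorem IsHodge.rel_twelfth_conductor_conj [NeZero m] {r : ℕ} {α : Fin r → ZMod m} (h : IsHodge α)
    {f : ℕ} [NeZero f] (h2 : ¬ 2 ∣ f) (h3 : ¬ 3 ∣ f) (hfm : f ∣ m) {χ : DirichletCharacter ℂ f}
    (hχ : χ.Odd) (hprim : χ.IsPrimitive) (M : Fin r → ℕ) [∀ i, NeZero (M i)] (hM : ∀ i, M i ∣ m)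
    (w : (i : Fin r) → ZMod (M i)) (hw : ∀ i, IsUnit (w i))
    (hα : ∀ i, α i = ((m / M i : ℕ) : ZMod m) * ((ZMod.val (w i) : ℕ) : ZMod m))
    (hlev : ∀ i, f ∣ M i → M i = f ∨ M i = 2 * f ∨ M i = 3 * f ∨ M i = 4 * f ∨ M i = 6 * f ∨
      M i = 12 * f) :
    ∑ i, (if M i = 12 * f then
        (1 - starRingEnd ℂ (χ 2)) * (1 - starRingEnd ℂ (χ 3)) * χ (ZMod.cast (w i) : ZMod f)
      else if M i = 6 * f then
        2 * (1 - starRingEnd ℂ (χ 2)) * (1 - starRingEnd ℂ (χ 3)) * χ (ZMod.cast (w i) : ZMod f)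
      else if M i = 4 * f then 2 * (1 - starRingEnd ℂ (χ 2)) * χ (ZMod.cast (w i) : ZMod f)
      else if M i = 3 * f then 2 * (1 - starRingEnd ℂ (χ 3)) * χ (ZMod.cast (w i) : ZMod f)
      else if M i = 2 * f then 4 * (1 - starRingEnd ℂ (χ 2)) * χ (ZMod.cast (w i) : ZMod f)
      else if M i = f then 4 * χ (ZMod.cast (w i) : ZMod f) else 0) = 0 := by
  classical
  have key := h.rel_twelfth_conductor h2 h3 hfm hχ hprim M hM w hw hα hlev
  -- conjugate: `(χ y)⁻¹ = conj (χ y)`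
  have hinv : ∀ y : ZMod f, (χ y)⁻¹ = starRingEnd ℂ (χ y) := by
    intro y
    by_cases hy : IsUnit y
    · exact Complex.inv_eq_conj (χ.unit_norm_eq_one hy.unit ▸ by rw [IsUnit.unit_spec])
    · rw [χ.map_nonunit hy, inv_zero, map_zero]
  have c2 : starRingEnd ℂ (2 : ℂ) = 2 := map_ofNat _ 2
  have c4 : starRingEnd ℂ (4 : ℂ) = 4 := map_ofNat _ 4
  have hterm : ∀ i, (if M i = 12 * f then
        (1 - starRingEnd ℂ (χ 2)) * (1 - starRingEnd ℂ (χ 3)) * χ (ZMod.cast (w i) : ZMod f)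
      else if M i = 6 * f then
        2 * (1 - starRingEnd ℂ (χ 2)) * (1 - starRingEnd ℂ (χ 3)) * χ (ZMod.cast (w i) : ZMod f)
      else if M i = 4 * f then 2 * (1 - starRingEnd ℂ (χ 2)) * χ (ZMod.cast (w i) : ZMod f)
      else if M i = 3 * f then 2 * (1 - starRingEnd ℂ (χ 3)) * χ (ZMod.cast (w i) : ZMod f)
      else if M i = 2 * f then 4 * (1 - starRingEnd ℂ (χ 2)) * χ (ZMod.cast (w i) : ZMod f)
      else if M i = f then 4 * χ (ZMod.cast (w i) : ZMod f) else 0) =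
      starRingEnd ℂ (if M i = 12 * f then (1 - χ 2) * (1 - χ 3) * (χ (ZMod.cast (w i) : ZMod f))⁻¹
        else if M i = 6 * f then 2 * (1 - χ 2) * (1 - χ 3) * (χ (ZMod.cast (w i) : ZMod f))⁻¹
        else if M i = 4 * f then 2 * (1 - χ 2) * (χ (ZMod.cast (w i) : ZMod f))⁻¹
        else if M i = 3 * f then 2 * (1 - χ 3) * (χ (ZMod.cast (w i) : ZMod f))⁻¹
        else if M i = 2 * f then 4 * (1 - χ 2) * (χ (ZMod.cast (w i) : ZMod f))⁻¹
        else if M i = f then 4 * (χ (ZMod.cast (w i) : ZMod f))⁻¹ else 0) := by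
    intro i
    by_cases h12' : M i = 12 * f
    · rw [if_pos h12', if_pos h12', map_mul, map_mul, map_sub, map_sub, map_one, map_inv₀, ← hinv 2,
        ← hinv 3, ← hinv (ZMod.cast (w i)), inv_inv]
    · rw [if_neg h12', if_neg h12']
      by_cases h6' : M i = 6 * f
      · rw [if_pos h6', if_pos h6', map_mul, map_mul, map_mul, map_sub, map_sub, map_one, map_inv₀,
          c2, ← hinv 2, ← hinv 3, ← hinv (ZMod.cast (w i)), inv_inv]
      · rw [if_neg h6', if_neg h6']
        by_cases h4' : M i = 4 * f
        · rw [if_pos h4', if_pos h4', map_mul, map_mul, map_sub, map_one, map_inv₀, c2, ← hinv 2,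
            ← hinv (ZMod.cast (w i)), inv_inv]
        · rw [if_neg h4', if_neg h4']
          by_cases h3' : M i = 3 * f
          · rw [if_pos h3', if_pos h3', map_mul, map_mul, map_sub, map_one, map_inv₀, c2, ← hinv 3,
              ← hinv (ZMod.cast (w i)), inv_inv]
          · rw [if_neg h3', if_neg h3']
            by_cases h2' : M i = 2 * f
            · rw [if_pos h2', if_pos h2', map_mul, map_mul, map_sub, map_one, map_inv₀, c4, ← hinv 2,
                ← hinv (ZMod.cast (w i)), inv_inv]
            · rw [if_neg h2', if_neg h2']
              by_cases h1 : M i = f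
              · rw [if_pos h1, if_pos h1, map_mul, map_inv₀, c4, ← hinv, inv_inv]
              · rw [if_neg h1, if_neg h1, map_zero]
  rw [Finset.sum_congr rfl fun i _ ↦ hterm i, ← map_sum, key, map_zero]

end TwelfthConductor

/-! ### The level `m = 12d`, `d` prime to `6`, at the conductor `d` (Aoki's `τ₁₂(α) ∈ A(m/12)` as a function of `α`) -/

section TwelfthLevel

variable {d : ℕ} [NeZero d]

omit [NeZero d] in
/-- `12d ≠ 0`. [folklore] -/
private theorem twelve_mul_ne_zero' (hd0 : d ≠ 0) : 12 * d ≠ 0 := mul_ne_zero (by norm_num) hd0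

/-- The reduction `ℤ/12d → ℤ/k` (`k ∣ 12d`) of `x` is the residue of `⟨x⟩`. [folklore] -/
private theorem castHom_eq_val_cast₁₂ {k : ℕ} (hk : k ∣ 12 * d) (x : ZMod (12 * d)) :
    ZMod.castHom hk (ZMod k) x = ((x.val : ℕ) : ZMod k) := by
  haveI : NeZero (12 * d) := ⟨twelve_mul_ne_zero' (NeZero.ne d)⟩
  conv_lhs => rw [← ZMod.natCast_zmod_val x]
  rw [map_natCast]

omit [NeZero d] in
/-- `gcd(⟨x⟩, 12d) = gcd(⟨x⟩, 4) · gcd(⟨x⟩, 3) · gcd(⟨x⟩, d)` for `d` prime to `6`. [folklore] -/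
private theorem gcd_twelve_mul_eq (hd2 : ¬ 2 ∣ d) (hd3 : ¬ 3 ∣ d) (a : ℕ) :
    (12 * d).gcd a = a.gcd 4 * a.gcd 3 * a.gcd d := by
  have hcop2 : Nat.Coprime 2 d := (Nat.Prime.coprime_iff_not_dvd Nat.prime_two).mpr hd2
  have hcop3 : Nat.Coprime 3 d := (Nat.Prime.coprime_iff_not_dvd Nat.prime_three).mpr hd3
  have hcop4 : Nat.Coprime 4 d := by
    rw [show (4 : ℕ) = 2 ^ 2 by norm_num]; exact Nat.Coprime.pow_left 2 hcop2
  have hcop12 : Nat.Coprime 12 d := by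
    rw [show (12 : ℕ) = 4 * 3 by norm_num]; exact Nat.Coprime.mul_left hcop4 hcop3
  rw [Nat.gcd_comm, Nat.Coprime.gcd_mul a hcop12, show (12 : ℕ) = 4 * 3 by norm_num,
    Nat.Coprime.gcd_mul a (by norm_num : Nat.Coprime 4 3)]

omit [NeZero d] in
/-- `gcd(a, p) = p` or `1` for a prime `p`, according as `p ∣ a` or not. [folklore] -/
private theorem gcd_prime_eq₁₂ {a p : ℕ} (hp : p.Prime) :
    (p ∣ a → a.gcd p = p) ∧ (¬ p ∣ a → a.gcd p = 1) :=
  ⟨fun h ↦ Nat.gcd_eq_right h,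
   fun h ↦ by rw [Nat.gcd_comm]; exact (Nat.Prime.coprime_iff_not_dvd hp).mpr h⟩

omit [NeZero d] in
/-- `gcd(a, 4)` is `4`, `2` or `1` according as `a ≡ 0`, `2` or `±1 (mod 4)`. [folklore] -/
private theorem gcd_four_eq (a : ℕ) :
    (a % 4 = 0 → a.gcd 4 = 4) ∧ (a % 4 = 2 → a.gcd 4 = 2) ∧ (a % 4 ≠ 0 → a % 4 ≠ 2 → a.gcd 4 = 1) := by
  have key : a.gcd 4 = (a % 4).gcd 4 := by
    rw [Nat.gcd_comm, Nat.gcd_rec, Nat.gcd_comm]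
  refine ⟨fun h ↦ ?_, fun h ↦ ?_, fun h0 h2 ↦ ?_⟩
  · rw [key, h]; rfl
  · rw [key, h]; rfl
  · have h4 : a % 4 < 4 := Nat.mod_lt a (by norm_num)
    rw [key]
    interval_cases (a % 4) <;> simp_all

/-- The `i`-th term of [Aoki1983, Prop. 2.2] at the conductor `d` for a coordinate `x ∈ ℤ/12d`
(`d` prime to `6`), as evaluated by `IsHodge.rel_twelfth_conductor` on the exact level
`M = 12d/gcd(12d, ⟨x⟩)` and unit part `w` of `x`, rewritten as a function of `x`: with `x̃ = x mod d`
and `g = gcd(12d, ⟨x⟩) ∈ {1, 2, 3, 4, 6, 12}` when `x̃` is a unit (read off from `x mod 4` and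
`x mod 3`), it is `weight(g) · Euler(12d/g) · χ(g) χ(x̃)⁻¹` (`x = g w`, `w̄ = g⁻¹ x̃`), and `0` when `x̃`
is not a unit. [cite: Aoki1983, Prop. 2.1 and Prop. 2.2 (the terms `L_ψ(αᵢ)`); §9 (III-7) p. 51] -/
private theorem twelfth_term (hd2 : ¬ 2 ∣ d) (hd3 : ¬ 3 ∣ d) (hd : d ∣ 12 * d) (h4 : 4 ∣ 12 * d)
    (h3 : 3 ∣ 12 * d) (x : ZMod (12 * d))
    [NeZero (12 * d / (12 * d).gcd x.val)] (w : ZMod (12 * d / (12 * d).gcd x.val))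
    (hwx : ((12 * d / (12 * d / (12 * d).gcd x.val) : ℕ) : ZMod (12 * d)) *
      ((w.val : ℕ) : ZMod (12 * d)) = x)
    (χ : DirichletCharacter ℂ d) :
    (if 12 * d / (12 * d).gcd x.val = 12 * d then
        (1 - χ 2) * (1 - χ 3) * (χ (ZMod.cast w : ZMod d))⁻¹
      else if 12 * d / (12 * d).gcd x.val = 6 * d then
        2 * (1 - χ 2) * (1 - χ 3) * (χ (ZMod.cast w : ZMod d))⁻¹
      else if 12 * d / (12 * d).gcd x.val = 4 * d then 2 * (1 - χ 2) * (χ (ZMod.cast w : ZMod d))⁻¹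
      else if 12 * d / (12 * d).gcd x.val = 3 * d then 2 * (1 - χ 3) * (χ (ZMod.cast w : ZMod d))⁻¹
      else if 12 * d / (12 * d).gcd x.val = 2 * d then 4 * (1 - χ 2) * (χ (ZMod.cast w : ZMod d))⁻¹
      else if 12 * d / (12 * d).gcd x.val = d then 4 * (χ (ZMod.cast w : ZMod d))⁻¹ else 0) =
      if IsUnit x then (1 - χ 2) * (1 - χ 3) * (χ (ZMod.castHom hd (ZMod d) x))⁻¹
      else if IsUnit (ZMod.castHom hd (ZMod d) x) then
        (if ZMod.castHom h4 (ZMod 4) x = 0 then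
          (if ZMod.castHom h3 (ZMod 3) x = 0 then 4 * χ 12 * (χ (ZMod.castHom hd (ZMod d) x))⁻¹
           else 2 * (1 - χ 3) * χ 4 * (χ (ZMod.castHom hd (ZMod d) x))⁻¹)
         else if ZMod.castHom h4 (ZMod 4) x = 2 then
          (if ZMod.castHom h3 (ZMod 3) x = 0 then 4 * (1 - χ 2) * χ 6 * (χ (ZMod.castHom hd (ZMod d) x))⁻¹
           else 2 * (1 - χ 2) * (1 - χ 3) * χ 2 * (χ (ZMod.castHom hd (ZMod d) x))⁻¹)
         else 2 * (1 - χ 2) * χ 3 * (χ (ZMod.castHom hd (ZMod d) x))⁻¹)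
      else 0 := by
  classical
  have hd0 : d ≠ 0 := NeZero.ne d
  haveI : NeZero (12 * d) := ⟨twelve_mul_ne_zero' hd0⟩
  have h12d0 : 0 < 12 * d := Nat.pos_of_ne_zero (twelve_mul_ne_zero' hd0)
  have hcop2 : Nat.Coprime 2 d := (Nat.Prime.coprime_iff_not_dvd Nat.prime_two).mpr hd2
  have hcop3 : Nat.Coprime 3 d := (Nat.Prime.coprime_iff_not_dvd Nat.prime_three).mpr hd3
  have hcop4 : Nat.Coprime 4 d := by
    rw [show (4 : ℕ) = 2 ^ 2 by norm_num]; exact Nat.Coprime.pow_left 2 hcop2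
  have hcop12 : Nat.Coprime 12 d := by
    rw [show (12 : ℕ) = 4 * 3 by norm_num]; exact Nat.Coprime.mul_left hcop4 hcop3
  set ψ := ZMod.castHom hd (ZMod d) with hψ
  -- the cast of `w` is the residue of `⟨w⟩`
  have hcw : (ZMod.cast w : ZMod d) = ((w.val : ℕ) : ZMod d) := ZMod.cast_eq_val w
  rw [hcw]
  -- the reductions of `x`
  have hψx : ψ x = ((x.val : ℕ) : ZMod d) := castHom_eq_val_cast₁₂ hd x
  have hx4 : ZMod.castHom h4 (ZMod 4) x = ((x.val : ℕ) : ZMod 4) := castHom_eq_val_cast₁₂ h4 x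
  have hx3 : ZMod.castHom h3 (ZMod 3) x = ((x.val : ℕ) : ZMod 3) := castHom_eq_val_cast₁₂ h3 x
  have hgx : (12 * d).gcd x.val = x.val.gcd 4 * x.val.gcd 3 * x.val.gcd d :=
    gcd_twelve_mul_eq hd2 hd3 x.val
  -- `ψ x` is a unit iff `⟨x⟩` is prime to `d`
  have hψu : IsUnit (ψ x) ↔ x.val.gcd d = 1 := by
    rw [hψx, ZMod.isUnit_iff_coprime, Nat.coprime_iff_gcd_eq_one]
  -- `x mod 4`
  have h40 : ZMod.castHom h4 (ZMod 4) x = 0 ↔ x.val % 4 = 0 := by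
    rw [hx4, ZMod.natCast_eq_zero_iff]; exact Nat.dvd_iff_mod_eq_zero
  have h42 : ZMod.castHom h4 (ZMod 4) x = 2 ↔ x.val % 4 = 2 := by
    rw [hx4, show (2 : ZMod 4) = ((2 : ℕ) : ZMod 4) by norm_cast, ZMod.natCast_eq_natCast_iff']
  -- `w̃` in terms of `x̃`: `k · w̃ = x̃` with `k = 12d/M`
  have hkw : ∀ k : ℕ, 12 * d / (12 * d / (12 * d).gcd x.val) = k →
      ((k : ℕ) : ZMod d) * ((w.val : ℕ) : ZMod d) = ψ x := by
    intro k hk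
    have := congrArg ψ hwx
    rwa [map_mul, map_natCast, map_natCast, hk] at this
  have hχinv : ∀ k : ℕ, IsUnit ((k : ℕ) : ZMod d) → 12 * d / (12 * d / (12 * d).gcd x.val) = k →
      (χ ((w.val : ℕ) : ZMod d))⁻¹ = χ (k : ZMod d) * (χ (ψ x))⁻¹ := by
    intro k hku hk
    have hk' := hkw k hk
    have hχk : χ (k : ZMod d) ≠ 0 := fun h0 ↦ by
      have := DirichletCharacter.unit_norm_eq_one χ hku.unit
      rw [IsUnit.unit_spec, h0, norm_zero] at this
      exact zero_ne_one this
    rw [← hk', map_mul, mul_inv, ← mul_assoc, mul_inv_cancel₀ hχk, one_mul]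
  have hunitk : ∀ k : ℕ, k ∣ 12 → IsUnit ((k : ℕ) : ZMod d) := by
    intro k hk
    rw [ZMod.isUnit_iff_coprime]
    exact Nat.Coprime.coprime_dvd_left hk hcop12
  have hne : d ≠ 12 * d ∧ d ≠ 6 * d ∧ d ≠ 4 * d ∧ d ≠ 3 * d ∧ d ≠ 2 * d ∧ 2 * d ≠ 12 * d ∧
      2 * d ≠ 6 * d ∧ 2 * d ≠ 4 * d ∧ 2 * d ≠ 3 * d ∧ 3 * d ≠ 12 * d ∧ 3 * d ≠ 6 * d ∧
      3 * d ≠ 4 * d ∧ 4 * d ≠ 12 * d ∧ 4 * d ≠ 6 * d ∧ 6 * d ≠ 12 * d := by omega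
  obtain ⟨hn1_12, hn1_6, hn1_4, hn1_3, hn1_2, hn2_12, hn2_6, hn2_4, hn2_3, hn3_12, hn3_6, hn3_4,
    hn4_12, hn4_6, hn6_12⟩ := hne
  by_cases hu : IsUnit x
  · -- unit: `g = 1`, `M = 12d`, `w = x`
    have hg1 : (12 * d).gcd x.val = 1 := by
      have h := ZMod.val_coe_unit_coprime hu.unit
      rw [IsUnit.unit_spec] at h
      rw [Nat.gcd_comm]; exact h
    have hM : 12 * d / (12 * d).gcd x.val = 12 * d := by rw [hg1, Nat.div_one]
    have hk : 12 * d / (12 * d / (12 * d).gcd x.val) = 1 := by rw [hM, Nat.div_self h12d0]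
    rw [if_pos hM, if_pos hu, hχinv 1 (hunitk 1 (by norm_num)) hk, Nat.cast_one, map_one, one_mul]
  · by_cases hu' : IsUnit (ψ x)
    · have hgd : x.val.gcd d = 1 := hψu.mp hu'
      rw [if_neg hu, if_pos hu']
      by_cases he0 : ZMod.castHom h4 (ZMod 4) x = 0
      · have hg4 : x.val.gcd 4 = 4 := (gcd_four_eq x.val).1 (h40.mp he0)
        rw [if_pos he0]
        by_cases ht : ZMod.castHom h3 (ZMod 3) x = 0
        · -- `12 ∣ x`, prime to `d`: `g = 12`, `M = d`, `x = 12w`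
          have h3x : 3 ∣ x.val := by rw [hx3] at ht; exact (ZMod.natCast_eq_zero_iff _ _).mp ht
          have hg3 : x.val.gcd 3 = 3 := (gcd_prime_eq₁₂ Nat.prime_three).1 h3x
          have hg : (12 * d).gcd x.val = 12 := by rw [hgx, hg4, hg3, hgd]
          have hM : 12 * d / (12 * d).gcd x.val = d := by rw [hg]; omega
          have hk : 12 * d / (12 * d / (12 * d).gcd x.val) = 12 := by
            rw [hM]; exact Nat.mul_div_cancel 12 (Nat.pos_of_ne_zero hd0)
          rw [if_pos ht, if_neg (by rw [hM]; exact hn1_12), if_neg (by rw [hM]; exact hn1_6),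
            if_neg (by rw [hM]; exact hn1_4), if_neg (by rw [hM]; exact hn1_3),
            if_neg (by rw [hM]; exact hn1_2), if_pos hM, hχinv 12 (hunitk 12 (by norm_num)) hk,
            Nat.cast_ofNat]
          ring
        · -- `4 ∣ x`, `3 ∤ x`, prime to `d`: `g = 4`, `M = 3d`, `x = 4w`
          have h3x : ¬ 3 ∣ x.val := by
            rw [hx3] at ht; exact fun h ↦ ht ((ZMod.natCast_eq_zero_iff _ _).mpr h)
          have hg3 : x.val.gcd 3 = 1 := (gcd_prime_eq₁₂ Nat.prime_three).2 h3x
          have hg : (12 * d).gcd x.val = 4 := by rw [hgx, hg4, hg3, hgd]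
          have hM : 12 * d / (12 * d).gcd x.val = 3 * d := by rw [hg]; omega
          have hk : 12 * d / (12 * d / (12 * d).gcd x.val) = 4 := by
            rw [hM]; exact Nat.div_eq_of_eq_mul_left (by omega) (by ring)
          rw [if_neg ht, if_neg (by rw [hM]; exact hn3_12), if_neg (by rw [hM]; exact hn3_6),
            if_neg (by rw [hM]; exact hn3_4), if_pos hM, hχinv 4 (hunitk 4 (by norm_num)) hk,
            Nat.cast_ofNat]
          ring
      · rw [if_neg he0]
        by_cases he2 : ZMod.castHom h4 (ZMod 4) x = 2
        · have hg4 : x.val.gcd 4 = 2 := (gcd_four_eq x.val).2.1 (h42.mp he2)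
          rw [if_pos he2]
          by_cases ht : ZMod.castHom h3 (ZMod 3) x = 0
          · -- `x ≡ 2 (mod 4)`, `3 ∣ x`, prime to `d`: `g = 6`, `M = 2d`, `x = 6w`
            have h3x : 3 ∣ x.val := by rw [hx3] at ht; exact (ZMod.natCast_eq_zero_iff _ _).mp ht
            have hg3 : x.val.gcd 3 = 3 := (gcd_prime_eq₁₂ Nat.prime_three).1 h3x
            have hg : (12 * d).gcd x.val = 6 := by rw [hgx, hg4, hg3, hgd]
            have hM : 12 * d / (12 * d).gcd x.val = 2 * d := by rw [hg]; omega
            have hk : 12 * d / (12 * d / (12 * d).gcd x.val) = 6 := by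
              rw [hM]; exact Nat.div_eq_of_eq_mul_left (by omega) (by ring)
            rw [if_pos ht, if_neg (by rw [hM]; exact hn2_12), if_neg (by rw [hM]; exact hn2_6),
              if_neg (by rw [hM]; exact hn2_4), if_neg (by rw [hM]; exact hn2_3), if_pos hM,
              hχinv 6 (hunitk 6 (by norm_num)) hk, Nat.cast_ofNat]
            ring
          · -- `x ≡ 2 (mod 4)`, `3 ∤ x`, prime to `d`: `g = 2`, `M = 6d`, `x = 2w`
            have h3x : ¬ 3 ∣ x.val := by
              rw [hx3] at ht; exact fun h ↦ ht ((ZMod.natCast_eq_zero_iff _ _).mpr h)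
            have hg3 : x.val.gcd 3 = 1 := (gcd_prime_eq₁₂ Nat.prime_three).2 h3x
            have hg : (12 * d).gcd x.val = 2 := by rw [hgx, hg4, hg3, hgd]
            have hM : 12 * d / (12 * d).gcd x.val = 6 * d := by rw [hg]; omega
            have hk : 12 * d / (12 * d / (12 * d).gcd x.val) = 2 := by
              rw [hM]; exact Nat.div_eq_of_eq_mul_left (by omega) (by ring)
            rw [if_neg ht, if_neg (by rw [hM]; exact hn6_12), if_pos hM,
              hχinv 2 (hunitk 2 (by norm_num)) hk, Nat.cast_ofNat]
            ring
        · -- `x` odd, not a unit, prime to `d`: `3 ∣ x`, `g = 3`, `M = 4d`, `x = 3w`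
          rw [if_neg he2]
          have hg4 : x.val.gcd 4 = 1 :=
            (gcd_four_eq x.val).2.2 (fun h ↦ he0 (h40.mpr h)) (fun h ↦ he2 (h42.mpr h))
          have h3x : 3 ∣ x.val := by
            by_contra h3x
            have hg3 : x.val.gcd 3 = 1 := (gcd_prime_eq₁₂ Nat.prime_three).2 h3x
            have hg1 : (12 * d).gcd x.val = 1 := by rw [hgx, hg4, hg3, hgd]
            apply hu
            rw [← ZMod.natCast_zmod_val x, ZMod.isUnit_iff_coprime, Nat.coprime_iff_gcd_eq_one,
              Nat.gcd_comm]
            exact hg1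
          have hg3 : x.val.gcd 3 = 3 := (gcd_prime_eq₁₂ Nat.prime_three).1 h3x
          have hg : (12 * d).gcd x.val = 3 := by rw [hgx, hg4, hg3, hgd]
          have hM : 12 * d / (12 * d).gcd x.val = 4 * d := by rw [hg]; omega
          have hk : 12 * d / (12 * d / (12 * d).gcd x.val) = 3 := by
            rw [hM]; exact Nat.div_eq_of_eq_mul_left (by omega) (by ring)
          rw [if_neg (by rw [hM]; exact hn4_12), if_neg (by rw [hM]; exact hn4_6), if_pos hM,
            hχinv 3 (hunitk 3 (by norm_num)) hk, Nat.cast_ofNat]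
          ring
    · -- `x̃` not a unit: the level of `x` is not a multiple of `d`
      have hgd : x.val.gcd d ≠ 1 := fun h ↦ hu' (hψu.mpr h)
      have hndvd : ∀ t : ℕ, 12 * d / (12 * d).gcd x.val = t * d → False := by
        intro t ht
        have hgdvd : (12 * d).gcd x.val ∣ 12 * d := Nat.gcd_dvd_left _ _
        have hmul : 12 * d / (12 * d).gcd x.val * (12 * d).gcd x.val = 12 * d :=
          Nat.div_mul_cancel hgdvd
        rw [ht] at hmul
        have htg : t * (12 * d).gcd x.val = 12 := by
          have : d * (t * (12 * d).gcd x.val) = d * 12 := by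
            rw [← mul_assoc, mul_comm d t, hmul, mul_comm]
          exact Nat.eq_of_mul_eq_mul_left (Nat.pos_of_ne_zero hd0) this
        have hg12 : (12 * d).gcd x.val ∣ 12 := ⟨t, by rw [mul_comm, htg]⟩
        have hgcop : Nat.Coprime ((12 * d).gcd x.val) d := Nat.Coprime.coprime_dvd_left hg12 hcop12
        have hxd : x.val.gcd d ∣ (12 * d).gcd x.val :=
          Nat.dvd_gcd ((Nat.gcd_dvd_right _ _).trans (dvd_mul_left d 12)) (Nat.gcd_dvd_left _ _)
        have h1 : x.val.gcd d ∣ Nat.gcd ((12 * d).gcd x.val) d :=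
          Nat.dvd_gcd hxd (Nat.gcd_dvd_right _ _)
        rw [hgcop] at h1
        exact hgd (Nat.dvd_one.mp h1)
      rw [if_neg hu, if_neg hu', if_neg (fun h ↦ hndvd 12 h), if_neg (fun h ↦ hndvd 6 h),
        if_neg (fun h ↦ hndvd 4 h), if_neg (fun h ↦ hndvd 3 h), if_neg (fun h ↦ hndvd 2 h),
        if_neg (fun h ↦ hndvd 1 (by rw [one_mul]; exact h))]

/-- **The Hodge condition at the level `m/12` for `m = 12d`, `d` prime to `6`** ([Aoki1983, Prop. 2.2]
at `f = d`, Aoki's "`τ₁₂(α) ∈ A(m/12)`", §9 (III-7) Case (iv); the conductor `n/3` for `m = 4n`,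
`n` odd, `3 ∥ n`): for a Hodge character `α : Fin r → ℤ/m` (`m = 12d`) and every odd primitive
character `χ` mod `d`, with `x̃ = x mod d` and over the coordinates `αᵢ` PRIME TO `d` only,
`∑_{unit} (1 - conj χ2)(1 - conj χ3) χ(α̃ᵢ) + 4 ∑_{12 ∣ αᵢ} conj χ(12) χ(α̃ᵢ)
  + 2 ∑_{4 ∣ αᵢ, 3 ∤ αᵢ} (1 - conj χ3) conj χ(4) χ(α̃ᵢ) + 4 ∑_{αᵢ ≡ 2 (4), 3 ∣ αᵢ} (1 - conj χ2) conj χ(6) χ(α̃ᵢ)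
  + 2 ∑_{αᵢ ≡ 2 (4), 3 ∤ αᵢ} (1 - conj χ2)(1 - conj χ3) conj χ(2) χ(α̃ᵢ)
  + 2 ∑_{αᵢ odd, 3 ∣ αᵢ} (1 - conj χ2) conj χ(3) χ(α̃ᵢ) = 0`
(coordinates sharing a prime with `d` do not contribute). With `2v₂ = -1`, `3v₃ = -1` in `ℤ/d`:
`(1 - conj χ2) χ(y) = χ(y) + χ(v₂y)`, `(1 - conj χ3) χ(y) = χ(y) + χ(v₃y)`. The divisibility
hypotheses `hd, h4, h3` only name the casts. [cite: Aoki1983, Prop. 2.2; §9 (III-7) Case (iv) p. 51] -/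
theorem IsHodge.rel_twelfth_level {m : ℕ} [NeZero m] {r : ℕ} {α : Fin r → ZMod m} (h : IsHodge α)
    (hm : m = 12 * d) (hd2 : ¬ 2 ∣ d) (hd3 : ¬ 3 ∣ d) (hd : d ∣ m) (h4 : 4 ∣ m) (h3 : 3 ∣ m)
    (χ : DirichletCharacter ℂ d) (hχ : χ.Odd) (hprim : χ.IsPrimitive) :
    ∑ i, (if IsUnit (α i) then
        (1 - starRingEnd ℂ (χ 2)) * (1 - starRingEnd ℂ (χ 3)) * χ (ZMod.castHom hd (ZMod d) (α i))
      else if IsUnit (ZMod.castHom hd (ZMod d) (α i)) then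
        (if ZMod.castHom h4 (ZMod 4) (α i) = 0 then
          (if ZMod.castHom h3 (ZMod 3) (α i) = 0 then
              4 * starRingEnd ℂ (χ 12) * χ (ZMod.castHom hd (ZMod d) (α i))
           else 2 * (1 - starRingEnd ℂ (χ 3)) * starRingEnd ℂ (χ 4) * χ (ZMod.castHom hd (ZMod d) (α i)))
         else if ZMod.castHom h4 (ZMod 4) (α i) = 2 then
          (if ZMod.castHom h3 (ZMod 3) (α i) = 0 then
              4 * (1 - starRingEnd ℂ (χ 2)) * starRingEnd ℂ (χ 6) * χ (ZMod.castHom hd (ZMod d) (α i))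
           else 2 * (1 - starRingEnd ℂ (χ 2)) * (1 - starRingEnd ℂ (χ 3)) * starRingEnd ℂ (χ 2) *
             χ (ZMod.castHom hd (ZMod d) (α i)))
         else 2 * (1 - starRingEnd ℂ (χ 2)) * starRingEnd ℂ (χ 3) * χ (ZMod.castHom hd (ZMod d) (α i)))
      else 0) = 0 := by
  classical
  subst hm
  have hd0 : d ≠ 0 := NeZero.ne d
  haveI : NeZero (12 * d) := ⟨twelve_mul_ne_zero' hd0⟩
  set ψ := ZMod.castHom hd (ZMod d) with hψ
  have H := fun i ↦ exists_unit_lift_eq (m := 12 * d) (α i)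
  choose w hwu hwx using fun i ↦ (H i).2
  haveI : ∀ i, NeZero (12 * d / (12 * d).gcd (α i).val) := fun i ↦
    ⟨(Nat.div_pos (Nat.le_of_dvd (NeZero.pos (12 * d)) (Nat.gcd_dvd_left _ _))
      (Nat.gcd_pos_of_pos_left _ (NeZero.pos (12 * d)))).ne'⟩
  -- the levels divisible by `d` are `d, 2d, 3d, 4d, 6d, 12d`
  have hlev : ∀ i, d ∣ 12 * d / (12 * d).gcd (α i).val →
      12 * d / (12 * d).gcd (α i).val = d ∨ 12 * d / (12 * d).gcd (α i).val = 2 * d ∨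
      12 * d / (12 * d).gcd (α i).val = 3 * d ∨ 12 * d / (12 * d).gcd (α i).val = 4 * d ∨
      12 * d / (12 * d).gcd (α i).val = 6 * d ∨ 12 * d / (12 * d).gcd (α i).val = 12 * d := by
    intro i hdi
    obtain ⟨t, ht⟩ := hdi
    have hM12 : 12 * d / (12 * d).gcd (α i).val ∣ 12 * d := (H i).1
    rw [ht] at hM12 ⊢
    have ht12 : t ∣ 12 := by
      obtain ⟨s, hs⟩ := hM12
      refine ⟨s, Nat.eq_of_mul_eq_mul_left (Nat.pos_of_ne_zero hd0) ?_⟩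
      have : d * (t * s) = 12 * d := by rw [← mul_assoc, ← hs]
      rw [this, mul_comm]
    have ht12' : t ≤ 12 := Nat.le_of_dvd (by norm_num) ht12
    have ht0 : 0 < t := Nat.pos_of_ne_zero (by rintro rfl; simp at ht12)
    interval_cases t <;> omega
  have key := h.rel_twelfth_conductor hd2 hd3 hd hχ hprim
    (fun i ↦ 12 * d / (12 * d).gcd (α i).val) (fun i ↦ (H i).1) w hwu (fun i ↦ (hwx i).symm)
    (fun i hdi ↦ by
      rcases hlev i hdi with h1 | h2' | h3' | h4' | h6' | h12'
      · exact Or.inl h1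
      · exact Or.inr (Or.inl h2')
      · exact Or.inr (Or.inr (Or.inl h3'))
      · exact Or.inr (Or.inr (Or.inr (Or.inl h4')))
      · exact Or.inr (Or.inr (Or.inr (Or.inr (Or.inl h6'))))
      · exact Or.inr (Or.inr (Or.inr (Or.inr (Or.inr h12')))))
  have key' : ∑ i, (if IsUnit (α i) then (1 - χ 2) * (1 - χ 3) * (χ (ψ (α i)))⁻¹
      else if IsUnit (ψ (α i)) then
        (if ZMod.castHom h4 (ZMod 4) (α i) = 0 then
          (if ZMod.castHom h3 (ZMod 3) (α i) = 0 then 4 * χ 12 * (χ (ψ (α i)))⁻¹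
           else 2 * (1 - χ 3) * χ 4 * (χ (ψ (α i)))⁻¹)
         else if ZMod.castHom h4 (ZMod 4) (α i) = 2 then
          (if ZMod.castHom h3 (ZMod 3) (α i) = 0 then 4 * (1 - χ 2) * χ 6 * (χ (ψ (α i)))⁻¹
           else 2 * (1 - χ 2) * (1 - χ 3) * χ 2 * (χ (ψ (α i)))⁻¹)
         else 2 * (1 - χ 2) * χ 3 * (χ (ψ (α i)))⁻¹)
      else 0) = 0 := by
    rw [Finset.sum_congr rfl fun i _ ↦ (twelfth_term hd2 hd3 hd h4 h3 (α i) (w i) (hwx i) χ).symm]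
    exact key
  -- conjugate: `(χ y)⁻¹ = conj (χ y)` and `χ k = conj (conj χ k)`
  have hinv : ∀ y : ZMod d, (χ y)⁻¹ = starRingEnd ℂ (χ y) := by
    intro y
    by_cases hy : IsUnit y
    · exact Complex.inv_eq_conj (χ.unit_norm_eq_one hy.unit ▸ by rw [IsUnit.unit_spec])
    · rw [χ.map_nonunit hy, inv_zero, map_zero]
  have c2 : starRingEnd ℂ (2 : ℂ) = 2 := map_ofNat _ 2
  have c4 : starRingEnd ℂ (4 : ℂ) = 4 := map_ofNat _ 4
  have hterm : ∀ i, (if IsUnit (α i) then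
        (1 - starRingEnd ℂ (χ 2)) * (1 - starRingEnd ℂ (χ 3)) * χ (ψ (α i))
      else if IsUnit (ψ (α i)) then
        (if ZMod.castHom h4 (ZMod 4) (α i) = 0 then
          (if ZMod.castHom h3 (ZMod 3) (α i) = 0 then 4 * starRingEnd ℂ (χ 12) * χ (ψ (α i))
           else 2 * (1 - starRingEnd ℂ (χ 3)) * starRingEnd ℂ (χ 4) * χ (ψ (α i)))
         else if ZMod.castHom h4 (ZMod 4) (α i) = 2 then
          (if ZMod.castHom h3 (ZMod 3) (α i) = 0 then
              4 * (1 - starRingEnd ℂ (χ 2)) * starRingEnd ℂ (χ 6) * χ (ψ (α i))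
           else 2 * (1 - starRingEnd ℂ (χ 2)) * (1 - starRingEnd ℂ (χ 3)) * starRingEnd ℂ (χ 2) *
             χ (ψ (α i)))
         else 2 * (1 - starRingEnd ℂ (χ 2)) * starRingEnd ℂ (χ 3) * χ (ψ (α i)))
      else 0) =
      starRingEnd ℂ (if IsUnit (α i) then (1 - χ 2) * (1 - χ 3) * (χ (ψ (α i)))⁻¹
      else if IsUnit (ψ (α i)) then
        (if ZMod.castHom h4 (ZMod 4) (α i) = 0 then
          (if ZMod.castHom h3 (ZMod 3) (α i) = 0 then 4 * χ 12 * (χ (ψ (α i)))⁻¹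
           else 2 * (1 - χ 3) * χ 4 * (χ (ψ (α i)))⁻¹)
         else if ZMod.castHom h4 (ZMod 4) (α i) = 2 then
          (if ZMod.castHom h3 (ZMod 3) (α i) = 0 then 4 * (1 - χ 2) * χ 6 * (χ (ψ (α i)))⁻¹
           else 2 * (1 - χ 2) * (1 - χ 3) * χ 2 * (χ (ψ (α i)))⁻¹)
         else 2 * (1 - χ 2) * χ 3 * (χ (ψ (α i)))⁻¹)
      else 0) := by
    intro i
    by_cases hu : IsUnit (α i)
    · rw [if_pos hu, if_pos hu, map_mul, map_mul, map_sub, map_sub, map_one, map_inv₀,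
        ← hinv (ψ (α i)), inv_inv]
    · rw [if_neg hu, if_neg hu]
      by_cases hu' : IsUnit (ψ (α i))
      · rw [if_pos hu', if_pos hu']
        by_cases he0 : ZMod.castHom h4 (ZMod 4) (α i) = 0
        · rw [if_pos he0, if_pos he0]
          by_cases ht : ZMod.castHom h3 (ZMod 3) (α i) = 0
          · rw [if_pos ht, if_pos ht, map_mul, map_mul, c4, map_inv₀, ← hinv (ψ (α i)), inv_inv]
          · rw [if_neg ht, if_neg ht, map_mul, map_mul, map_mul, c2, map_sub, map_one, map_inv₀,
              ← hinv (ψ (α i)), inv_inv]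
        · rw [if_neg he0, if_neg he0]
          by_cases he2 : ZMod.castHom h4 (ZMod 4) (α i) = 2
          · rw [if_pos he2, if_pos he2]
            by_cases ht : ZMod.castHom h3 (ZMod 3) (α i) = 0
            · rw [if_pos ht, if_pos ht, map_mul, map_mul, map_mul, c4, map_sub, map_one, map_inv₀,
                ← hinv (ψ (α i)), inv_inv]
            · rw [if_neg ht, if_neg ht, map_mul, map_mul, map_mul, map_mul, c2, map_sub, map_sub,
                map_one, map_inv₀, ← hinv (ψ (α i)), inv_inv]
          · rw [if_neg he2, if_neg he2, map_mul, map_mul, map_mul, c2, map_sub, map_one, map_inv₀,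
              ← hinv (ψ (α i)), inv_inv]
      · rw [if_neg hu', if_neg hu', map_zero]
  rw [Finset.sum_congr rfl fun i _ ↦ hterm i, ← map_sum, key', map_zero]

end TwelfthLevel

end FermatCharacter

end Literature.AlgebraicGeometry.HodgeTheory
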